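import Summits.HodgeConjecture.HodgeConjecture.Theorems.Ring2TransportCommutantDeligneCriterion
import Summits.HodgeConjecture.HodgeConjecture.Theorems.Ring2TransportCMTypeMumfordTateTorus
import Literature.AlgebraicGeometry.Motives.AbelianVarietyEndAlgebraSemisimple
import HarnessLib

/-!
# Ring 2 transport — node 44, converse half: a commutative Mumford–Tate group forces CM-type, modulo ONE
typed residual (Deligne I Prop. 5.1 `⇒`; part 4 of 4)

research route conditional on HC_CM; not a corollary; Q11.4-sentence-2 already refuted in dim ≥ 3.

Cell `pub-hodge-ring2`, seat `transport`, gen 51; helper file riding `--supports` the umbrella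
`Theses.RankFourFaces.CMToAbelian` (stmt-HodgeConjecture-16267). `HC_CM = Theses.RankFourFaces.CMAbelianHodge`
stays a hypothesis everywhere; nothing here is a case of HC.

## What is PROVED (sorry-free, std axioms; parts 1–3 = `Ring2TransportCommutantBaseChange`,
`Ring2TransportCommutantEtale`, `Ring2TransportCommutantDeligneCriterion`, pure algebra)

Node 44 of the binder tree is the open named hypothesis `Ring2Transport.CMTypeIffMumfordTateCommutative` ("of
CM-type iff `MT(A)(ℂ)` is commutative", Deligne LNM 900, I §5 Prop. 5.1; recalled in I §6, proof of Prop. 6.1,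
orig. p. 61 = Milne re-ed. p. 42). Gen 50 proved its forward half unconditionally
(`mumfordTateGroup_comm_of_isOfCMType`) and reduced the node to its converse half
(`cmTypeIffMumfordTateCommutative_iff_converse`). This file proves the CONVERSE HALF modulo one typed residual
`HodgeGroupH1CommutantSpan` (R below), by the linear algebra of Deligne's proof of I Prop. 5.1, direction `⇒`
(printed sentences, verbatim: "Therefore E is the commutant of G in End(H₁(A,ℚ))" and "The commutant of G therefore
contains étale commutative algebras of rank dim H₁(A,ℚ) over ℚ"; everything else below is OUR paraphrase):

* `isOfCMType_of_hodgeGroup_comm`, `isOfCMType_of_mumfordTateGroup_comm` — R ∧ (`Hg(A)(ℂ)` resp. `MT(A)(ℂ)`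
  commutative) ⟹ `IsOfCMType A`, from part 3's `Commutant.exists_subalgebra_comm_reduced_of_commutant` with
  `R₀ = End⁰(A)` (semisimple: Mumford §19 Cor. 2, `isSemisimpleRing_endAlgebra_of_isAlgClosed`; faithful on
  `H¹(A(ℂ); ℚ)`: `bettiRep_injective`; `dim H¹ = 2 dim A`: `finrank_bettiCohomology_one`), `K = ℂ`,
  `G = Hg(A)(ℂ)|_{H¹}` transported to `ℂ ⊗ H¹(A(ℂ); ℚ)` through `ofRatClassBaseChangeEquiv`
  (`hodgeGroup_apply_map`: `Hg` commutes with pull-backs);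
* the EDGE `cmTypeIffMumfordTateCommutative_of_hodgeGroupH1CommutantSpan : R → CMTypeIffMumfordTateCommutative`
  (with gen 50's forward half), i.e. node 44 is REDUCED TO R;
* the unconditional inclusion `End⁰(A) ⊗ ℂ ⊆ C(Hg(A)(ℂ)|_{H¹})` (`commute_hodgeGroup_of_mem_span_complexBetti_map`).

## What is NOT proved, and exactly why

R = `HodgeGroupH1CommutantSpan`: "every `ℂ`-endomorphism of `H¹(A(ℂ); ℂ)` commuting with `Hg(A)(ℂ)` is a
`ℂ`-combination of pull-backs `φ^*`, `φ ∈ End A`", i.e. `C(Hg(A)(ℂ)|_{H¹}) ⊆ End⁰(A) ⊗ ℂ`. In print: Deligne I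
Prop. 3.4 (`Hg` is the `ℚ`-group fixing exactly the Hodge classes) + Riemann's theorem (`End⁰(A) = End_HS H¹(A, ℚ)`,
Birkenhake–Lange Thm. 1.1.21 with Prop. 1.1.6(b)) + base change of invariants for a `ℚ`-group. On the tree's
carriers `HodgeTheory.hodgeGroup` is Tannaka-free (the `ℂ`-automorphisms of `⊕ₖ Hᵏ(A(ℂ); ℂ)` compatible with
`⋀` and fixing the RATIONAL Hodge classes of the powers): it has no `ℚ`-structure, and "an element of `End(H¹_ℂ)`
fixed by it is a `ℂ`-combination of rational Hodge classes" needs exactly the missing link between its `ℂ`-points and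
the `ℚ`-group (equivalently: enough elements of `hodgeGroup` to cut the commutant down to `End⁰ ⊗ ℂ`). R is therefore
declared as OUR `@[conjecture] def` (status open; a theorem in print — the tree's `hodgeGroup` contains the `ℂ`-points
of Deligne's `Hg(A)`, so its commutant is even smaller), never as a Literature fact, and used only as a binder.
Fullness on `H¹` ALONE would not suffice on these carriers (a commutative `Hg(A)(ℂ)|_{H¹}` larger than a maximal
torus with `End⁰(A) = ℚ` is not excluded by them), which is why R is typed as the span statement. Without R the
converse half of node 44 stays open; node 44's `def` is untouched.

References: Deligne, *Hodge cycles on abelian varieties*, LNM 900 (1982), I §3 Prop. 3.4, I §5 Prop. 5.1, I §6 proof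
of Prop. 6.1 (orig. p. 61 = Milne re-ed. p. 42);
Mumford, *Abelian Varieties* (1970) §19 Cor. 2 of Thm. 1; Mumford (1969) §2; Birkenhake–Lange / Lange (2023)
Prop. 1.1.6(b), Thm. 1.1.21; Milne (1999) §2.
-/

set_option linter.dupNamespace false

noncomputable section

open CategoryTheory

namespace Summit.HodgeConjecture.HodgeConjecture.Ring2Transport

/-! ## §6 Complex abelian varieties: the residual R and the converse half of node 44 modulo R -/

open Literature.AlgebraicGeometry Literature.AlgebraicGeometry.Motives
open Literature.AlgebraicGeometry.HodgeTheory
open Literature.AlgebraicGeometry.ComplexMultiplication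
open Literature.AlgebraicGeometry.Milne1999 (IsOfCMType)
open scoped TensorProduct

/-- **Residual input R (OPEN NAMED HYPOTHESIS in Lean; THEOREM IN PRINT; ours, not a citation of a tree fact).**
For a complex abelian variety `A`: every `ℂ`-linear endomorphism of `H¹(A(ℂ); ℂ)` commuting with the Hodge group
`Hg(A)(ℂ)` (the tree's Tannaka-free `HodgeTheory.hodgeGroup (dim A) A.X`, acting in degree 1) lies in the
`ℂ`-span of the pull-backs `φ^*`, `φ ∈ End A` — "`End⁰(A) ⊗ ℂ` is the commutant of `Hg(A)` in `End(H¹(A, ℂ))`".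
In print this is Deligne I Prop. 3.4 (the `ℚ`-Zariski closure `Hg(A)` fixes exactly the Hodge classes in the
tensor spaces) + Riemann's theorem `End⁰(A) = End_HS(H¹(A, ℚ))` (fullness on `H¹ ⊗ H¹^∨`) + base change of
invariants `(End H¹_ℚ)^{Hg} ⊗ ℂ = (End H¹_ℂ)^{Hg(ℂ)}`; it is TRUE for the tree's `hodgeGroup` as well, which
CONTAINS the `ℂ`-points of Deligne's `Hg(A)` (so its commutant is smaller), but none of the three inputs is on the
tree's carriers: no `ℚ`-structure / Zariski closure on `hodgeGroup`, fullness only as the open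
`AbelianVarietyHodgeHomFullness`-type statements. The reverse inclusion is unconditional
(`commute_hodgeGroup_of_mem_span_complexBetti_map`). NOT asserted; used only as a binder. GEN 52: R is DERIVED
in the tree from the ONE cited record of Riemann's theorem, `HodgeTheory.DeligneMilne1982_Thm_6_20_full` (the
displayed binder `hR` of stage 2, `CorCM/Interfaces.lean`), by `Ring2TransportRiemannCommutantSpan.lean`,
`hodgeGroupH1CommutantSpan_of_riemann : DeligneMilne1982_Thm_6_20_full → HodgeGroupH1CommutantSpan` (Deligne's
road: `Aut(ℂ)`-stability of `Hg` + Galois descent + the torus element `T_{2,1/2} ∈ Hg` + Riemann), so node 44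
rests on that record alone (`cmTypeIffMumfordTateCommutative_of_riemann`). Print locus of R itself: Lange 2023
Prop. 7.2.5 «End_ℚ(X) ≃ End(V)^{Hg(X)}» = §7.2.4 Exercise (3), tensored with `ℂ` and transposed to `H¹ = V^*`.
[cite: Deligne1982HodgeCycles, I §3 Prop. 3.4 (Milne re-ed. p. 24)]
[cite: Deligne1982HodgeCycles, I §5 Prop. 5.1 (proof, re-ed. p. 36: "E is the commutant of G")]
[cite: Lange2023AbelianVarietiesComplex, Prop. 7.2.5, §7.2.4 Exercise (3); Prop. 1.1.6(b) and Thm. 1.1.21]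
[status: open as typed; proved modulo the cited record DeligneMilne1982_Thm_6_20_full (gen 52)] -/
@[conjecture] def HodgeGroupH1CommutantSpan : Prop :=
  ∀ (A : AbelianVariety ℂ) (x : complexBetti A.X 1 →ₗ[ℂ] complexBetti A.X 1),
    (∀ g ∈ hodgeGroup A.dim A.X, ∀ y : complexBetti A.X 1, x (g 1 y) = g 1 (x y)) →
      x ∈ Submodule.span ℂ (Set.range fun φ : (A ⟶ A) => (complexBetti.map φ.hom.hom.hom 1).hom)

variable {A : AbelianVariety ℂ}

/-- **The unconditional inclusion `End⁰(A) ⊗ ℂ ⊆` commutant of `Hg(A)(ℂ)` on `H¹`**: every element of the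
`ℂ`-span of the pull-backs `φ^*` (`φ ∈ End A`) commutes with `Hg(A)(ℂ)|_{H¹}` (`hodgeGroup_apply_map`: the Hodge
group commutes with pull-backs along self-maps). [cite: Deligne1982HodgeCycles, I §5 Prop. 5.1 (proof)] -/
theorem commute_hodgeGroup_of_mem_span_complexBetti_map {x : complexBetti A.X 1 →ₗ[ℂ] complexBetti A.X 1}
    (hx : x ∈ Submodule.span ℂ (Set.range fun φ : (A ⟶ A) => (complexBetti.map φ.hom.hom.hom 1).hom))
    {g : ∀ k : ℕ, complexBetti A.X k ≃ₗ[ℂ] complexBetti A.X k} (hg : g ∈ hodgeGroup A.dim A.X)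
    (y : complexBetti A.X 1) : x (g 1 y) = g 1 (x y) := by
  have hX := AbelianVariety.isSmoothProjective_holds (A := A)
  induction hx using Submodule.span_induction generalizing y with
  | mem x hx =>
    obtain ⟨φ, rfl⟩ := hx
    exact (hodgeGroup_apply_map hX hg φ.hom.hom.hom 1 y).symm
  | zero => rw [LinearMap.zero_apply, LinearMap.zero_apply, map_zero]
  | add x x' _ _ hx hx' => rw [LinearMap.add_apply, LinearMap.add_apply, map_add, hx, hx']
  | smul c x _ hx => rw [LinearMap.smul_apply, LinearMap.smul_apply, map_smul, hx]

/-- **Deligne I Prop. 5.1, `⇒`, modulo R: a commutative Hodge group forces CM-type.** If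
`HodgeGroupH1CommutantSpan` holds and `Hg(A)(ℂ)` is commutative, then `A` is of CM-type: `End⁰(A)` is semisimple
(Mumford §19 Cor. 2, `isSemisimpleRing_endAlgebra_of_isAlgClosed`), acts faithfully on `H¹(A(ℂ); ℚ)`
(`bettiRep_injective`) of dimension `2 dim A` (`finrank_bettiCohomology_one`), commutes with `Hg(A)(ℂ)`
(`hodgeGroup_apply_map` through `ofRatClassBaseChangeEquiv`), and by R its complexification is the commutant of
the commuting set `Hg(A)(ℂ)|_{H¹}`; `Commutant.exists_subalgebra_comm_reduced_of_commutant` then produces the CM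
subalgebra. [cite: Deligne1982HodgeCycles, I §5 Prop. 5.1 (proof, direction ⇒)] [cite: MumfordAV1970, §19 Cor. 2
of Thm. 1 (p. 174)] -/
theorem isOfCMType_of_hodgeGroup_comm (hR : HodgeGroupH1CommutantSpan)
    (hcomm : ∀ g ∈ hodgeGroup A.dim A.X, ∀ g' ∈ hodgeGroup A.dim A.X, g * g' = g' * g) :
    IsOfCMType A := by
  classical
  haveI : IsSemisimpleRing A.endAlgebra := AbelianVariety.isSemisimpleRing_endAlgebra_of_isAlgClosed A
  haveI : Module.Finite ℚ (bettiCohomology A.X 1) := finite_bettiCohomology_one A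
  have hX := AbelianVariety.isSmoothProjective_holds (A := A)
  -- `H¹(A(ℂ); ℂ) = ℂ ⊗ H¹(A(ℂ); ℚ)`, compatibly with pull-backs
  obtain ⟨β, hβ⟩ : ∃ β : ℂ ⊗[ℚ] bettiCohomology A.X 1 ≃ₗ[ℂ] complexBetti A.X 1,
      ∀ (Fm : A.X ⟶ A.X) (t : ℂ ⊗[ℚ] bettiCohomology A.X 1),
        complexBetti.map Fm 1 (β t) = β ((bettiCohomology.map Fm 1).hom.baseChange ℂ t) :=
    ⟨ofRatClassBaseChangeEquiv hX 1, fun Fm t => complexBetti_map_ofRatClassBaseChangeEquiv hX hX Fm t⟩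
  -- the rational representation `ρ r = op (r^*)` and its complexification
  let ρ : A.endAlgebra →ₐ[ℚ] (Module.End ℚ (bettiCohomology A.X 1))ᵐᵒᵖ := bettiRep A
  have hρC : ∀ r : A.endAlgebra, ∃ (c : ℂ) (Fm : A.X ⟶ A.X),
      ∀ t, β ((MulOpposite.unop (ρ r)).baseChange ℂ t) = c • complexBetti.map Fm 1 (β t) := by
    intro r
    obtain ⟨M, Fe, hM, hs⟩ := AbelianVariety.endAlgebra.exists_eq_algebraMap_mul_of r
    refine ⟨algebraMap ℚ ℂ ((M : ℚ)⁻¹), Fe.hom.hom.hom, fun t => ?_⟩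
    have hρs : MulOpposite.unop (ρ r) = ((M : ℚ)⁻¹ : ℚ) • (bettiCohomology.map Fe.hom.hom.hom 1).hom := by
      change MulOpposite.unop (bettiRep A r) = _
      rw [hs, map_mul, AlgHom.commutes, bettiRep_of, Algebra.algebraMap_eq_smul_one, smul_mul_assoc,
        one_mul, MulOpposite.unop_smul, MulOpposite.unop_op]
    rw [hρs, LinearMap.baseChange_smul, LinearMap.smul_apply,
      ← algebraMap_smul ℂ ((M : ℚ)⁻¹) (((bettiCohomology.map Fe.hom.hom.hom 1).hom.baseChange ℂ) t),
      map_smul, hβ]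
  -- `Hg(A)(ℂ)|_{H¹}` transported to `ℂ ⊗ H¹(A(ℂ); ℚ)`
  let U : (∀ k : ℕ, complexBetti A.X k ≃ₗ[ℂ] complexBetti A.X k) →
      Module.End ℂ (ℂ ⊗[ℚ] bettiCohomology A.X 1) :=
    fun h => β.symm.toLinearMap ∘ₗ (h 1).toLinearMap ∘ₗ β.toLinearMap
  have hU : ∀ (h : ∀ k : ℕ, complexBetti A.X k ≃ₗ[ℂ] complexBetti A.X k) (t : ℂ ⊗[ℚ] bettiCohomology A.X 1),
      U h t = β.symm (h 1 (β t)) := fun h t => rfl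
  let G : Set (Module.End ℂ (ℂ ⊗[ℚ] bettiCohomology A.X 1)) :=
    {u | ∃ h ∈ hodgeGroup A.dim A.X, U h = u}
  -- `G` is commutative
  have hG : ∀ u ∈ G, ∀ u' ∈ G, u * u' = u' * u := by
    rintro _ ⟨h, hh, rfl⟩ _ ⟨h', hh', rfl⟩
    apply LinearMap.ext
    intro t
    have e1 : ∀ y, h 1 (h' 1 y) = h' 1 (h 1 y) := fun y => by
      have := congrFun (congrArg (fun m : (∀ k : ℕ, complexBetti A.X k ≃ₗ[ℂ] complexBetti A.X k) => ⇑(m 1))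
        (hcomm h hh h' hh')) y
      exact this
    rw [Module.End.mul_apply, Module.End.mul_apply, hU, hU, hU, hU, LinearEquiv.apply_symm_apply,
      LinearEquiv.apply_symm_apply, e1]
  -- `G` commutes with `End⁰(A)`
  have hT1 : ∀ (r : A.endAlgebra), ∀ u ∈ G, u * (MulOpposite.unop (ρ r)).baseChange ℂ =
      (MulOpposite.unop (ρ r)).baseChange ℂ * u := by
    rintro r _ ⟨h, hh, rfl⟩
    obtain ⟨c, Fm, hc⟩ := hρC r
    apply LinearMap.ext
    intro t
    rw [Module.End.mul_apply, Module.End.mul_apply, hU, hU]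
    apply β.injective
    rw [LinearEquiv.apply_symm_apply, hc, hc, map_smul, hodgeGroup_apply_map hX hh Fm 1,
      LinearEquiv.apply_symm_apply]
  -- R: the commutant of `G` is spanned by `End⁰(A)`
  have hRR : ∀ x : Module.End ℂ (ℂ ⊗[ℚ] bettiCohomology A.X 1), (∀ u ∈ G, x * u = u * x) →
      x ∈ Submodule.span ℂ (Set.range fun r : A.endAlgebra => (MulOpposite.unop (ρ r)).baseChange ℂ) := by
    intro x hx
    -- transport `x` to `H¹(A(ℂ); ℂ)`
    let x' : complexBetti A.X 1 →ₗ[ℂ] complexBetti A.X 1 := β.toLinearMap ∘ₗ x ∘ₗ β.symm.toLinearMap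
    have hx' : ∀ g ∈ hodgeGroup A.dim A.X, ∀ y : complexBetti A.X 1, x' (g 1 y) = g 1 (x' y) := by
      intro g hg y
      have h1 := LinearMap.congr_fun (hx (U g) ⟨g, hg, rfl⟩) (β.symm y)
      rw [Module.End.mul_apply, Module.End.mul_apply, hU, hU, LinearEquiv.apply_symm_apply] at h1
      change β (x (β.symm (g 1 y))) = g 1 (β (x (β.symm y)))
      rw [h1, LinearEquiv.apply_symm_apply]
    have hmem := hR A x' hx'
    -- conjugation back by `β`
    let conj : (complexBetti A.X 1 →ₗ[ℂ] complexBetti A.X 1) →ₗ[ℂ]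
        Module.End ℂ (ℂ ⊗[ℚ] bettiCohomology A.X 1) :=
      { toFun := fun f => β.symm.toLinearMap ∘ₗ f ∘ₗ β.toLinearMap
        map_add' := fun f f' => by
          simp only [LinearMap.add_comp, LinearMap.comp_add]
        map_smul' := fun c f => by
          simp only [LinearMap.smul_comp, LinearMap.comp_smul, RingHom.id_apply] }
    have hconjx : conj x' = x := by
      apply LinearMap.ext
      intro t
      change β.symm (β (x (β.symm (β t)))) = x t
      rw [LinearEquiv.symm_apply_apply, LinearEquiv.symm_apply_apply]
    rw [← hconjx]
    have hmem' := Submodule.mem_map_of_mem (f := conj) hmem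
    rw [Submodule.map_span] at hmem'
    refine Submodule.span_mono ?_ hmem'
    rintro _ ⟨_, ⟨φ, rfl⟩, rfl⟩
    refine ⟨AbelianVariety.endAlgebra.of A φ, ?_⟩
    change (MulOpposite.unop (bettiRep A (AbelianVariety.endAlgebra.of A φ))).baseChange ℂ = conj _
    rw [bettiRep_of, MulOpposite.unop_op]
    apply LinearMap.ext
    intro t
    change _ = β.symm ((complexBetti.map φ.hom.hom.hom 1).hom (β t))
    rw [LinearEquiv.eq_symm_apply]
    exact (hβ φ.hom.hom.hom t).symm
  obtain ⟨S, hred, hcommS, hdim⟩ :=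
    Commutant.exists_subalgebra_comm_reduced_of_commutant (K := ℂ) ρ bettiRep_injective G hG hT1 hRR
  exact ⟨S, hred, hcommS, by rw [hdim, finrank_bettiCohomology_one]⟩

/-- **MT(A)(ℂ) commutative ⟹ CM-type, modulo R** (`Hg ≤ MT`, `hodgeGroup_le_mumfordTateGroup`).
[cite: Deligne1982HodgeCycles, I §5 Prop. 5.1 (proof, direction ⇒); I §6 proof of Prop. 6.1 (orig. p. 61; re-ed. p. 42)] -/
theorem isOfCMType_of_mumfordTateGroup_comm (hR : HodgeGroupH1CommutantSpan)
    (hcomm : ∀ g ∈ mumfordTateGroup A.dim A.X, ∀ g' ∈ mumfordTateGroup A.dim A.X, g * g' = g' * g) :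
    IsOfCMType A :=
  isOfCMType_of_hodgeGroup_comm hR fun g hg g' hg' =>
    hcomm g (hodgeGroup_le_mumfordTateGroup hg) g' (hodgeGroup_le_mumfordTateGroup hg')

/-! ## §7 The edge to node 44 -/

/-- **EDGE: R ⟹ node 44.** Under the residual `HodgeGroupH1CommutantSpan` (open; theorem in print) the open named
hypothesis `CMTypeIffMumfordTateCommutative` ("of CM-type iff the Mumford–Tate group is commutative", Deligne LNM
900, I §5 Prop. 5.1; I §6 proof of Prop. 6.1, orig. p. 61 = Milne re-ed. p. 42) HOLDS: `→` is gen 50's unconditional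
`cmType_imp_mumfordTateGroup_comm`, `←` is `isOfCMType_of_mumfordTateGroup_comm`. Node 44 is thereby reduced to R;
it is NOT proved outright (gen 52: R, hence node 44, follows from the cited Riemann record
`DeligneMilne1982_Thm_6_20_full` — `Ring2TransportRiemannCommutantSpan.lean`).
[cite: Deligne1982HodgeCycles, I §5 Prop. 5.1; I §6 proof of Prop. 6.1 (orig. p. 61; re-ed. p. 42)]
[status: conditional on HodgeGroupH1CommutantSpan] -/
theorem cmTypeIffMumfordTateCommutative_of_hodgeGroupH1CommutantSpan (hR : HodgeGroupH1CommutantSpan) :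
    CMTypeIffMumfordTateCommutative :=
  cmTypeIffMumfordTateCommutative_iff_converse.2 fun _ hc => isOfCMType_of_mumfordTateGroup_comm hR hc

/-- The same edge as an implication between the two named statements (for the binder census). [folklore] -/
theorem hodgeGroupH1CommutantSpan_imp_cmTypeIffMumfordTateCommutative :
    HodgeGroupH1CommutantSpan → CMTypeIffMumfordTateCommutative :=
  cmTypeIffMumfordTateCommutative_of_hodgeGroupH1CommutantSpan

/-! ## Audit: the abstract criterion (§5) and `isOfCMType_of_mumfordTateGroup_comm` carry R as an explicit binder and
no other open hypothesis; std axioms only. -/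

#print axioms Summit.HodgeConjecture.HodgeConjecture.Ring2Transport.Commutant.exists_subalgebra_comm_reduced_of_commutant
#print axioms Summit.HodgeConjecture.HodgeConjecture.Ring2Transport.cmTypeIffMumfordTateCommutative_of_hodgeGroupH1CommutantSpan

/-! ## Audit: `isOfCMType_of_mumfordTateGroup_comm` and the edge carry R as an explicit binder and no other open
hypothesis; std axioms only. -/

#print axioms Summit.HodgeConjecture.HodgeConjecture.Ring2Transport.isOfCMType_of_mumfordTateGroup_comm
#print axioms Summit.HodgeConjecture.HodgeConjecture.Ring2Transport.cmTypeIffMumfordTateCommutative_of_hodgeGroupH1CommutantSpan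

end Summit.HodgeConjecture.HodgeConjecture.Ring2Transport

end
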